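import Mathlib
import Summits.CriticalPhenomena.CardyFormulaZ2.Theorems.CardySelfRefinementGradientComparabilityStubNonAxialShareBulkReroute
import Summits.CriticalPhenomena.CardyFormulaZ2.Theorems.CardySelfRefinementExactEndpoints
import HarnessLib

/-!
# Local surgery on crossings of a quad: opening a staple minus one edge creates no crossing

Helper file for the stub `stub_nonAxialShare_bulk` (D4-bulk) of the line `Sketch` (crux
`stmt-CriticalPhenomena-10269`, `…Theses.CardySelfRefinement.GradientComparability`).  The
transfer of pivotality from an axial bulk edge `e = {p, q}` (closed; `p` linked in the
non-crossing configuration `σ` to `∂_{jp}Q` only, `q` to `∂_{jq}Q` only, `{jp, jq} = {0, 2}`) to a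
non-axial edge `e'` opens a short detour `S ∋ e'` around `e` (possibly after closing one or two
feeding edges of a leaf) and needs `σ' ∪ (S ∖ {e'})` NOT to cross `Q`.  This file proves the six
"no crossing" statements of the case analysis, all from `not_crossing_union` (registered
sub-goal; the working form of the three-way decomposition `not_crossing_of_links`): it suffices
that no end of the `p`-side part of `S ∖ {e'}` is linked to `∂_{jq}Q`, no end of the `q`-side part
to `∂_{jp}Q`, and that the two parts are not joined —

* level 1 (the cell `p, q, q', p'` beside `e`): `not_crossing_staple_mid` (posts `{p,p'}`,
  `{q,q'}` open, rail `{p',q'}` the candidate), `not_crossing_staple_end` (post and rail open, far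
  post the candidate);
* level 2 (`p` a leaf of `σ` fed through `{c, p}`, which is closed; detour `c, c', p', p, q`):
  `not_crossing_lev2_end`, `not_crossing_lev2_mid`;
* level 3 (`c` of degree two, fed through `{cc, c}`, also closed; detour `cc, cc', c', c, p, q`):
  `not_crossing_lev3_end`, `not_crossing_lev3_mid`.

No percolation, no named fact.
-/

noncomputable section

namespace Summit.CriticalPhenomena.CardyFormulaZ2.Theorems.CardySelfRefinement

open scoped Topology
open Filter Set MeasureTheory Metric
open Literature.Probability.LatticeModels Literature.Probability.Percolation
open Literature.Probability.Percolation.QuadCrossing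

variable {D : Set ℂ} {δ : ℝ}


/-! ## Surgery lemmas: opening a staple minus one edge creates no crossing -/

/-- An end of an unordered pair. -/
theorem eq_or_eq_of_sym2_eq {x x' a b : Site 2} (h : s(x, x') = s(a, b)) : x = a ∨ x = b := by
  rcases Sym2.eq_iff.1 h with ⟨h1, -⟩ | ⟨h1, -⟩
  exacts [Or.inl h1, Or.inr h1]

/-- A link passes along a junction. -/
theorem link_of_joinedIn {F : Set ℂ} {S : Set ℂ} {u v : ℂ} (h : ∃ a ∈ S, JoinedIn F a u)
    (hJ : JoinedIn F u v) : ∃ a ∈ S, JoinedIn F a v :=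
  let ⟨a, ha, hJa⟩ := h; ⟨a, ha, hJa.trans hJ⟩

/-- **No crossing after opening `A ∪ B` over `τ`** — the working form of
`not_crossing_of_links`: `A`, `B` are sets of bulk edges (drawn in the interior of `[Q]`, with
disjoint drawings); it suffices that no end of `A` is linked in `τ` to `∂_{jq}Q`, no end of `B` to
`∂_{jp}Q`, and no end of `A` is joined in `τ` to an end of `B`. -/
theorem not_crossing_union {D : Set ℂ} {δ : ℝ} (hδ : 0 < δ) (Q : Quad D) {τ A B : BondConfig (Site 2)}
    {jp jq : Fin 4} (hj : (jp = 0 ∧ jq = 2) ∨ (jp = 2 ∧ jq = 0))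
    (hτ : ¬ ∃ a ∈ Q.side 0, ∃ b ∈ Q.side 2, JoinedIn (Q.carrier ∩ openEdgeUnion δ τ) a b)
    (hAB : ∀ z ∈ openEdgeUnion δ A, z ∉ openEdgeUnion δ B)
    (hint : ∀ z ∈ openEdgeUnion δ (A ∪ B), z ∈ interior Q.carrier)
    (hVp : ∀ x x', (zdGraph 2).Adj x x' → s(x, x') ∈ A →
      ¬ ∃ b ∈ Q.side jq, JoinedIn (Q.carrier ∩ openEdgeUnion δ τ) b (meshPoint δ x))
    (hVq : ∀ y y', (zdGraph 2).Adj y y' → s(y, y') ∈ B →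
      ¬ ∃ a ∈ Q.side jp, JoinedIn (Q.carrier ∩ openEdgeUnion δ τ) a (meshPoint δ y))
    (hJ : ∀ x x' y y', (zdGraph 2).Adj x x' → s(x, x') ∈ A → (zdGraph 2).Adj y y' →
      s(y, y') ∈ B → ¬ JoinedIn (Q.carrier ∩ openEdgeUnion δ τ) (meshPoint δ x) (meshPoint δ y)) :
    ¬ ∃ a ∈ Q.side 0, ∃ b ∈ Q.side 2, JoinedIn (Q.carrier ∩ openEdgeUnion δ (τ ∪ A ∪ B)) a b := by
  have key := not_crossing_of_links hδ Q (Sp := A \ τ) (Sq := B \ τ) hj hτ (fun e he => he.2)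
    (fun e he => he.2)
    (fun z hz hz' => hAB z (openEdgeUnion_mono δ Set.sdiff_subset hz)
      (openEdgeUnion_mono δ Set.sdiff_subset hz'))
    (fun z hz => by
      have hz' : z ∈ interior Q.carrier :=
        hint z (openEdgeUnion_mono δ (Set.union_subset_union Set.sdiff_subset Set.sdiff_subset) hz)
      exact ⟨notMem_side_of_mem_interior Q hz' 0, notMem_side_of_mem_interior Q hz' 2⟩)
    (fun x x' hxx' hx => hVp x x' hxx' hx.1) (fun y y' hyy' hy => hVq y y' hyy' hy.1)
    (fun x x' y y' hxx' hx hyy' hy => hJ x x' y y' hxx' hx.1 hyy' hy.1)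
  rintro ⟨a, ha, b, hb, hJab⟩
  refine key ⟨a, ha, b, hb, joinedIn_mono_config δ Q (fun e he => ?_) hJab⟩
  rcases he with (he | he) | he
  · exact Or.inl (Or.inl he)
  · by_cases h : e ∈ τ
    exacts [Or.inl (Or.inl h), Or.inl (Or.inr ⟨he, h⟩)]
  · by_cases h : e ∈ τ
    exacts [Or.inl (Or.inl h), Or.inr ⟨he, h⟩]

/-- **Level 1, middle edge.**  `e = {p, q}` closed, `p` linked (in `σ`, not crossing `Q`) to
`∂_{jp}Q` only and `q` to `∂_{jq}Q` only; the cell `p, q, q', p'` on one side.  If `p'` is not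
linked to `∂_{jq}Q`, `q'` not to `∂_{jp}Q`, and `p'`, `q'` are not joined, then opening the two
posts `{p, p'}`, `{q, q'}` creates no crossing. -/
theorem not_crossing_staple_mid (hδ : 0 < δ) (Q : Quad D) {σ : BondConfig (Site 2)}
    {jp jq : Fin 4} (hj : (jp = 0 ∧ jq = 2) ∨ (jp = 2 ∧ jq = 0))
    (hσ : ¬ ∃ a ∈ Q.side 0, ∃ b ∈ Q.side 2, JoinedIn (Q.carrier ∩ openEdgeUnion δ σ) a b)
    {p q p' q' : Site 2} (hpp' : (zdGraph 2).Adj p p') (hqq' : (zdGraph 2).Adj q q')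
    (h₁ : p ≠ q) (h₂ : p ≠ q') (h₃ : p' ≠ q) (h₄ : p' ≠ q')
    (hint : ∀ z ∈ openEdgeUnion δ ({s(p, p'), s(q, q')} : Set _), z ∈ interior Q.carrier)
    (hpL : ∃ a ∈ Q.side jp, JoinedIn (Q.carrier ∩ openEdgeUnion δ σ) a (meshPoint δ p))
    (hpR : ¬ ∃ b ∈ Q.side jq, JoinedIn (Q.carrier ∩ openEdgeUnion δ σ) b (meshPoint δ p))
    (hqR : ∃ b ∈ Q.side jq, JoinedIn (Q.carrier ∩ openEdgeUnion δ σ) b (meshPoint δ q))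
    (hqL : ¬ ∃ a ∈ Q.side jp, JoinedIn (Q.carrier ∩ openEdgeUnion δ σ) a (meshPoint δ q))
    (hp' : ¬ ∃ b ∈ Q.side jq, JoinedIn (Q.carrier ∩ openEdgeUnion δ σ) b (meshPoint δ p'))
    (hq' : ¬ ∃ a ∈ Q.side jp, JoinedIn (Q.carrier ∩ openEdgeUnion δ σ) a (meshPoint δ q'))
    (hp'q' : ¬ JoinedIn (Q.carrier ∩ openEdgeUnion δ σ) (meshPoint δ p') (meshPoint δ q')) :
    ¬ ∃ a ∈ Q.side 0, ∃ b ∈ Q.side 2,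
      JoinedIn (Q.carrier ∩ openEdgeUnion δ (σ ∪ {s(p, p')} ∪ {s(q, q')})) a b := by
  refine not_crossing_union hδ Q hj hσ (fun z hz hz' => ?_) hint ?_ ?_ ?_
  · have h1 := openEdgeUnion_singleton_subset δ p p' hz
    have h2 := openEdgeUnion_singleton_subset δ q q' hz'
    exact segment_disjoint_of_ne hδ.ne' hpp' hqq' h₁ h₂ h₃ h₄ h1 h2
  · intro x x' _ hx
    rcases eq_or_eq_of_sym2_eq (Set.mem_singleton_iff.1 hx) with rfl | rfl
    exacts [hpR, hp']
  · intro y y' _ hy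
    rcases eq_or_eq_of_sym2_eq (Set.mem_singleton_iff.1 hy) with rfl | rfl
    exacts [hqL, hq']
  · intro x x' y y' _ hx _ hy hJ
    rcases eq_or_eq_of_sym2_eq (Set.mem_singleton_iff.1 hx) with rfl | rfl <;>
      rcases eq_or_eq_of_sym2_eq (Set.mem_singleton_iff.1 hy) with rfl | rfl
    · exact hqL (link_of_joinedIn hpL hJ)
    · exact hq' (link_of_joinedIn hpL hJ)
    · exact hp' (link_of_joinedIn hqR hJ.symm)
    · exact hp'q' hJ

/-- **Level 1, end post.**  Same cell; if neither `p'` nor `q'` is linked to `∂_{jq}Q`, then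
opening the post `{p, p'}` and the rail `{p', q'}` creates no crossing. -/
theorem not_crossing_staple_end (hδ : 0 < δ) (Q : Quad D) {σ : BondConfig (Site 2)}
    {jp jq : Fin 4} (hj : (jp = 0 ∧ jq = 2) ∨ (jp = 2 ∧ jq = 0))
    (hσ : ¬ ∃ a ∈ Q.side 0, ∃ b ∈ Q.side 2, JoinedIn (Q.carrier ∩ openEdgeUnion δ σ) a b)
    {p p' q' : Site 2}
    (hint : ∀ z ∈ openEdgeUnion δ ({s(p, p'), s(p', q')} : Set _), z ∈ interior Q.carrier)
    (hpR : ¬ ∃ b ∈ Q.side jq, JoinedIn (Q.carrier ∩ openEdgeUnion δ σ) b (meshPoint δ p))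
    (hp' : ¬ ∃ b ∈ Q.side jq, JoinedIn (Q.carrier ∩ openEdgeUnion δ σ) b (meshPoint δ p'))
    (hq' : ¬ ∃ b ∈ Q.side jq, JoinedIn (Q.carrier ∩ openEdgeUnion δ σ) b (meshPoint δ q')) :
    ¬ ∃ a ∈ Q.side 0, ∃ b ∈ Q.side 2,
      JoinedIn (Q.carrier ∩ openEdgeUnion δ (σ ∪ {s(p, p'), s(p', q')} ∪ ∅)) a b := by
  refine not_crossing_union hδ Q hj hσ (fun z _ hz' => ?_) (by rwa [Set.union_empty]) ?_
    (fun y y' _ hy => absurd hy (Set.notMem_empty _)) (fun x x' y y' _ _ _ hy => absurd hy (Set.notMem_empty _))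
  · obtain ⟨x, y, -, h, -⟩ := mem_openEdgeUnion_iff.1 hz'
    exact absurd h (Set.notMem_empty _)
  · intro x x' _ hx
    rcases hx with hx | hx
    · rcases eq_or_eq_of_sym2_eq hx with rfl | rfl
      exacts [hpR, hp']
    · rcases eq_or_eq_of_sym2_eq (Set.mem_singleton_iff.1 hx) with rfl | rfl
      exacts [hp', hq']

/-- **Level 2, end post** (at the feeding edge `{c, p}` of the leaf `p`, removed).  With
`τ₁ = σ ∖ {{c, p}}`: if `c'` is not linked to `∂_{jp}Q`, opening `{c', p'}, {p', p}, {p, q}`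
creates no crossing. -/
theorem not_crossing_lev2_end (hδ : 0 < δ) (Q : Quad D) {σ : BondConfig (Site 2)}
    {jp jq : Fin 4} (hj : (jp = 0 ∧ jq = 2) ∨ (jp = 2 ∧ jq = 0))
    (hσ : ¬ ∃ a ∈ Q.side 0, ∃ b ∈ Q.side 2, JoinedIn (Q.carrier ∩ openEdgeUnion δ σ) a b)
    {c p q c' p' : Site 2} (hpc : (zdGraph 2).Adj p c)
    (hleaf : ∀ y, (zdGraph 2).Adj p y → s(p, y) ∈ σ → y = c)
    (hint : ∀ z ∈ openEdgeUnion δ ({s(c', p'), s(p', p), s(p, q)} : Set _), z ∈ interior Q.carrier)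
    (hqR : ∃ b ∈ Q.side jq, JoinedIn (Q.carrier ∩ openEdgeUnion δ σ) b (meshPoint δ q))
    (hqL : ¬ ∃ a ∈ Q.side jp, JoinedIn (Q.carrier ∩ openEdgeUnion δ σ) a (meshPoint δ q))
    (hp'R : ∃ b ∈ Q.side jq, JoinedIn (Q.carrier ∩ openEdgeUnion δ σ) b (meshPoint δ p'))
    (hc' : ¬ ∃ a ∈ Q.side jp, JoinedIn (Q.carrier ∩ openEdgeUnion δ σ) a (meshPoint δ c')) :
    ¬ ∃ a ∈ Q.side 0, ∃ b ∈ Q.side 2, JoinedIn (Q.carrier ∩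
      openEdgeUnion δ (σ \ {s(c, p)} ∪ ∅ ∪ {s(c', p'), s(p', p), s(p, q)})) a b := by
  have hsub : σ \ {s(c, p)} ⊆ σ := Set.sdiff_subset
  have hτ : ¬ ∃ a ∈ Q.side 0, ∃ b ∈ Q.side 2,
      JoinedIn (Q.carrier ∩ openEdgeUnion δ (σ \ {s(c, p)})) a b :=
    fun ⟨a, ha, b, hb, hJ⟩ => hσ ⟨a, ha, b, hb, joinedIn_mono_config δ Q hsub hJ⟩
  have hiso : ∀ y, (zdGraph 2).Adj p y → s(p, y) ∉ σ \ {s(c, p)} := fun y hy h =>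
    h.2 (by rw [hleaf y hy h.1, Sym2.eq_swap]; rfl)
  refine not_crossing_union hδ Q hj hτ (fun z hz _ => ?_) (by rwa [Set.empty_union])
    (fun x x' _ hx => absurd hx (Set.notMem_empty _)) ?_
    (fun x x' y y' _ hx _ _ => absurd hx (Set.notMem_empty _))
  · obtain ⟨x, y, -, h, -⟩ := mem_openEdgeUnion_iff.1 hz
    exact absurd h (Set.notMem_empty _)
  · intro y y' _ hy hL
    have hL' := link_mono δ Q hsub hL
    rcases hy with hy | hy | hy
    · rcases eq_or_eq_of_sym2_eq hy with rfl | rfl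
      · exact hc' hL'
      · exact hσ (crossing_of_two_links Q hj hL' hp'R)
    · rcases eq_or_eq_of_sym2_eq hy with rfl | rfl
      · exact hσ (crossing_of_two_links Q hj hL' hp'R)
      · exact not_joinedIn_of_isolated hδ Q hiso _ hL.choose_spec.2
    · rcases eq_or_eq_of_sym2_eq (Set.mem_singleton_iff.1 hy) with rfl | rfl
      · exact not_joinedIn_of_isolated hδ Q hiso _ hL.choose_spec.2
      · exact hqL hL'

/-- Points of the drawing of `insert {a, b} S` lie on the segment of `{a, b}` or in the drawing
of `S`. -/
theorem mem_openEdgeUnion_insert {δ : ℝ} {S : BondConfig (Site 2)} {a b : Site 2} {z : ℂ}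
    (hz : z ∈ openEdgeUnion δ (insert s(a, b) S)) :
    z ∈ segment ℝ (meshPoint δ a) (meshPoint δ b) ∨ z ∈ openEdgeUnion δ S := by
  rw [Set.insert_eq, openEdgeUnion_union] at hz
  rcases hz with hz | hz
  exacts [Or.inl (openEdgeUnion_singleton_subset δ a b hz), Or.inr hz]

/-- **Level 2, middle rail** (feeding edge `{c, p}` of the leaf `p` removed, `τ₁ = σ ∖ {{c, p}}`).
If `c` and `c'` are not linked to `∂_{jq}Q`, opening `{c, c'}` and `{p', p}, {p, q}` creates no
crossing. -/
theorem not_crossing_lev2_mid (hδ : 0 < δ) (Q : Quad D) {σ : BondConfig (Site 2)}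
    {jp jq : Fin 4} (hj : (jp = 0 ∧ jq = 2) ∨ (jp = 2 ∧ jq = 0))
    (hσ : ¬ ∃ a ∈ Q.side 0, ∃ b ∈ Q.side 2, JoinedIn (Q.carrier ∩ openEdgeUnion δ σ) a b)
    {c p q c' p' : Site 2} (hpc : (zdGraph 2).Adj p c) (hcc' : (zdGraph 2).Adj c c')
    (hp'p : (zdGraph 2).Adj p' p) (hpq : (zdGraph 2).Adj p q)
    (n₁ : c ≠ p') (n₂ : c ≠ p) (n₃ : c ≠ q) (n₄ : c' ≠ p') (n₅ : c' ≠ p) (n₆ : c' ≠ q)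
    (hleaf : ∀ y, (zdGraph 2).Adj p y → s(p, y) ∈ σ → y = c)
    (hint : ∀ z ∈ openEdgeUnion δ ({s(c, c'), s(p', p), s(p, q)} : Set _), z ∈ interior Q.carrier)
    (hqR : ∃ b ∈ Q.side jq, JoinedIn (Q.carrier ∩ openEdgeUnion δ σ) b (meshPoint δ q))
    (hqL : ¬ ∃ a ∈ Q.side jp, JoinedIn (Q.carrier ∩ openEdgeUnion δ σ) a (meshPoint δ q))
    (hp'R : ∃ b ∈ Q.side jq, JoinedIn (Q.carrier ∩ openEdgeUnion δ σ) b (meshPoint δ p'))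
    (hcR : ¬ ∃ b ∈ Q.side jq, JoinedIn (Q.carrier ∩ openEdgeUnion δ σ) b (meshPoint δ c))
    (hc' : ¬ ∃ b ∈ Q.side jq, JoinedIn (Q.carrier ∩ openEdgeUnion δ σ) b (meshPoint δ c')) :
    ¬ ∃ a ∈ Q.side 0, ∃ b ∈ Q.side 2, JoinedIn (Q.carrier ∩
      openEdgeUnion δ (σ \ {s(c, p)} ∪ {s(c, c')} ∪ {s(p', p), s(p, q)})) a b := by
  have hsub : σ \ {s(c, p)} ⊆ σ := Set.sdiff_subset
  have hτ : ¬ ∃ a ∈ Q.side 0, ∃ b ∈ Q.side 2,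
      JoinedIn (Q.carrier ∩ openEdgeUnion δ (σ \ {s(c, p)})) a b :=
    fun ⟨a, ha, b, hb, hJ⟩ => hσ ⟨a, ha, b, hb, joinedIn_mono_config δ Q hsub hJ⟩
  have hiso : ∀ y, (zdGraph 2).Adj p y → s(p, y) ∉ σ \ {s(c, p)} := fun y hy h =>
    h.2 (by rw [hleaf y hy h.1, Sym2.eq_swap]; rfl)
  refine not_crossing_union hδ Q hj hτ (fun z hz hz' => ?_)
    (by rwa [Set.singleton_union]) ?_ ?_ ?_
  · have h1 := openEdgeUnion_singleton_subset δ c c' hz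
    rcases mem_openEdgeUnion_insert hz' with h2 | h2
    · exact segment_disjoint_of_ne hδ.ne' hcc' hp'p n₁ n₂ n₄ n₅ h1 h2
    · exact segment_disjoint_of_ne hδ.ne' hcc' hpq n₂ n₃ n₅ n₆ h1
        (openEdgeUnion_singleton_subset δ p q h2)
  · intro x x' _ hx hL
    rcases eq_or_eq_of_sym2_eq (Set.mem_singleton_iff.1 hx) with rfl | rfl
    exacts [hcR (link_mono δ Q hsub hL), hc' (link_mono δ Q hsub hL)]
  · intro y y' _ hy hL
    have hL' := link_mono δ Q hsub hL
    rcases hy with hy | hy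
    · rcases eq_or_eq_of_sym2_eq hy with rfl | rfl
      · exact hσ (crossing_of_two_links Q hj hL' hp'R)
      · exact not_joinedIn_of_isolated hδ Q hiso _ hL.choose_spec.2
    · rcases eq_or_eq_of_sym2_eq (Set.mem_singleton_iff.1 hy) with rfl | rfl
      · exact not_joinedIn_of_isolated hδ Q hiso _ hL.choose_spec.2
      · exact hqL hL'
  · intro x x' y y' _ hx _ hy hJ
    have hJ' := joinedIn_mono_config δ Q hsub hJ
    have hy' : y = p' ∨ y = p ∨ y = q := by
      rcases hy with hy | hy
      · rcases eq_or_eq_of_sym2_eq hy with rfl | rfl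
        exacts [Or.inl rfl, Or.inr (Or.inl rfl)]
      · rcases eq_or_eq_of_sym2_eq (Set.mem_singleton_iff.1 hy) with rfl | rfl
        exacts [Or.inr (Or.inl rfl), Or.inr (Or.inr rfl)]
    have hx' : x = c ∨ x = c' := eq_or_eq_of_sym2_eq (Set.mem_singleton_iff.1 hx)
    rcases hy' with rfl | rfl | rfl
    · rcases hx' with rfl | rfl
      exacts [hcR (link_of_joinedIn hp'R hJ'.symm), hc' (link_of_joinedIn hp'R hJ'.symm)]
    · exact not_joinedIn_of_isolated hδ Q hiso _ hJ
    · rcases hx' with rfl | rfl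
      exacts [hcR (link_of_joinedIn hqR hJ'.symm), hc' (link_of_joinedIn hqR hJ'.symm)]

/-- **Level 3, end post** (feeding edges `{c, p}`, `{cc, c}` removed,
`τ₂ = σ ∖ {{c, p}, {cc, c}}`; `p` a leaf on `c`, `c` of degree two).  If `cc'` is not linked
to `∂_{jp}Q`, opening `{cc', c'}, {c', c}, {c, p}, {p, q}` creates no crossing. -/
theorem not_crossing_lev3_end (hδ : 0 < δ) (Q : Quad D) {σ : BondConfig (Site 2)}
    {jp jq : Fin 4} (hj : (jp = 0 ∧ jq = 2) ∨ (jp = 2 ∧ jq = 0))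
    (hσ : ¬ ∃ a ∈ Q.side 0, ∃ b ∈ Q.side 2, JoinedIn (Q.carrier ∩ openEdgeUnion δ σ) a b)
    {cc c p q cc' c' : Site 2} (hpc : (zdGraph 2).Adj p c) (hccc : (zdGraph 2).Adj c cc)
    (hleafp : ∀ y, (zdGraph 2).Adj p y → s(p, y) ∈ σ → y = c)
    (hleafc : ∀ y, (zdGraph 2).Adj c y → s(c, y) ∈ σ → y = p ∨ y = cc)
    (hint : ∀ z ∈ openEdgeUnion δ ({s(cc', c'), s(c', c), s(c, p), s(p, q)} : Set _),
      z ∈ interior Q.carrier)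
    (hqL : ¬ ∃ a ∈ Q.side jp, JoinedIn (Q.carrier ∩ openEdgeUnion δ σ) a (meshPoint δ q))
    (hc'R : ∃ b ∈ Q.side jq, JoinedIn (Q.carrier ∩ openEdgeUnion δ σ) b (meshPoint δ c'))
    (hcc' : ¬ ∃ a ∈ Q.side jp, JoinedIn (Q.carrier ∩ openEdgeUnion δ σ) a (meshPoint δ cc')) :
    ¬ ∃ a ∈ Q.side 0, ∃ b ∈ Q.side 2, JoinedIn (Q.carrier ∩
      openEdgeUnion δ (σ \ {s(c, p), s(cc, c)} ∪ ∅ ∪ {s(cc', c'), s(c', c), s(c, p), s(p, q)})) a b := by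
  have hsub : σ \ {s(c, p), s(cc, c)} ⊆ σ := Set.sdiff_subset
  have hτ : ¬ ∃ a ∈ Q.side 0, ∃ b ∈ Q.side 2,
      JoinedIn (Q.carrier ∩ openEdgeUnion δ (σ \ {s(c, p), s(cc, c)})) a b :=
    fun ⟨a, ha, b, hb, hJ⟩ => hσ ⟨a, ha, b, hb, joinedIn_mono_config δ Q hsub hJ⟩
  have hisop : ∀ y, (zdGraph 2).Adj p y → s(p, y) ∉ σ \ {s(c, p), s(cc, c)} := fun y hy h =>
    h.2 (Or.inl (by rw [hleafp y hy h.1, Sym2.eq_swap]))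
  have hisoc : ∀ y, (zdGraph 2).Adj c y → s(c, y) ∉ σ \ {s(c, p), s(cc, c)} := fun y hy h => by
    rcases hleafc y hy h.1 with rfl | rfl
    · exact h.2 (Or.inl rfl)
    · exact h.2 (Or.inr (by rw [Sym2.eq_swap]; rfl))
  refine not_crossing_union hδ Q hj hτ (fun z hz _ => ?_) (by rwa [Set.empty_union])
    (fun x x' _ hx => absurd hx (Set.notMem_empty _)) ?_
    (fun x x' y y' _ hx _ _ => absurd hx (Set.notMem_empty _))
  · obtain ⟨x, y, -, h, -⟩ := mem_openEdgeUnion_iff.1 hz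
    exact absurd h (Set.notMem_empty _)
  · intro y y' _ hy hL
    have hL' := link_mono δ Q hsub hL
    rcases hy with hy | hy | hy | hy
    · rcases eq_or_eq_of_sym2_eq hy with rfl | rfl
      · exact hcc' hL'
      · exact hσ (crossing_of_two_links Q hj hL' hc'R)
    · rcases eq_or_eq_of_sym2_eq hy with rfl | rfl
      · exact hσ (crossing_of_two_links Q hj hL' hc'R)
      · exact not_joinedIn_of_isolated hδ Q hisoc _ hL.choose_spec.2
    · rcases eq_or_eq_of_sym2_eq hy with rfl | rfl
      · exact not_joinedIn_of_isolated hδ Q hisoc _ hL.choose_spec.2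
      · exact not_joinedIn_of_isolated hδ Q hisop _ hL.choose_spec.2
    · rcases eq_or_eq_of_sym2_eq (Set.mem_singleton_iff.1 hy) with rfl | rfl
      · exact not_joinedIn_of_isolated hδ Q hisop _ hL.choose_spec.2
      · exact hqL hL'

/-- **Level 3, middle rail.**  Same situation; if `cc` and `cc'` are not linked to `∂_{jq}Q`,
opening `{cc, cc'}` and `{c', c}, {c, p}, {p, q}` creates no crossing. -/
theorem not_crossing_lev3_mid (hδ : 0 < δ) (Q : Quad D) {σ : BondConfig (Site 2)}
    {jp jq : Fin 4} (hj : (jp = 0 ∧ jq = 2) ∨ (jp = 2 ∧ jq = 0))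
    (hσ : ¬ ∃ a ∈ Q.side 0, ∃ b ∈ Q.side 2, JoinedIn (Q.carrier ∩ openEdgeUnion δ σ) a b)
    {cc c p q cc' c' : Site 2} (hpc : (zdGraph 2).Adj p c) (hccc : (zdGraph 2).Adj c cc)
    (hcccc' : (zdGraph 2).Adj cc cc') (hc'c : (zdGraph 2).Adj c' c) (hcp : (zdGraph 2).Adj c p)
    (hpq : (zdGraph 2).Adj p q)
    (n₁ : cc ≠ c') (n₂ : cc ≠ c) (n₃ : cc ≠ p) (n₄ : cc ≠ q)
    (n₅ : cc' ≠ c') (n₆ : cc' ≠ c) (n₇ : cc' ≠ p) (n₈ : cc' ≠ q)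
    (hleafp : ∀ y, (zdGraph 2).Adj p y → s(p, y) ∈ σ → y = c)
    (hleafc : ∀ y, (zdGraph 2).Adj c y → s(c, y) ∈ σ → y = p ∨ y = cc)
    (hint : ∀ z ∈ openEdgeUnion δ ({s(cc, cc'), s(c', c), s(c, p), s(p, q)} : Set _),
      z ∈ interior Q.carrier)
    (hqR : ∃ b ∈ Q.side jq, JoinedIn (Q.carrier ∩ openEdgeUnion δ σ) b (meshPoint δ q))
    (hqL : ¬ ∃ a ∈ Q.side jp, JoinedIn (Q.carrier ∩ openEdgeUnion δ σ) a (meshPoint δ q))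
    (hc'R : ∃ b ∈ Q.side jq, JoinedIn (Q.carrier ∩ openEdgeUnion δ σ) b (meshPoint δ c'))
    (hccR : ¬ ∃ b ∈ Q.side jq, JoinedIn (Q.carrier ∩ openEdgeUnion δ σ) b (meshPoint δ cc))
    (hcc' : ¬ ∃ b ∈ Q.side jq, JoinedIn (Q.carrier ∩ openEdgeUnion δ σ) b (meshPoint δ cc')) :
    ¬ ∃ a ∈ Q.side 0, ∃ b ∈ Q.side 2, JoinedIn (Q.carrier ∩
      openEdgeUnion δ (σ \ {s(c, p), s(cc, c)} ∪ {s(cc, cc')} ∪ {s(c', c), s(c, p), s(p, q)})) a b := by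
  have hsub : σ \ {s(c, p), s(cc, c)} ⊆ σ := Set.sdiff_subset
  have hτ : ¬ ∃ a ∈ Q.side 0, ∃ b ∈ Q.side 2,
      JoinedIn (Q.carrier ∩ openEdgeUnion δ (σ \ {s(c, p), s(cc, c)})) a b :=
    fun ⟨a, ha, b, hb, hJ⟩ => hσ ⟨a, ha, b, hb, joinedIn_mono_config δ Q hsub hJ⟩
  have hisop : ∀ y, (zdGraph 2).Adj p y → s(p, y) ∉ σ \ {s(c, p), s(cc, c)} := fun y hy h =>
    h.2 (Or.inl (by rw [hleafp y hy h.1, Sym2.eq_swap]))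
  have hisoc : ∀ y, (zdGraph 2).Adj c y → s(c, y) ∉ σ \ {s(c, p), s(cc, c)} := fun y hy h => by
    rcases hleafc y hy h.1 with rfl | rfl
    · exact h.2 (Or.inl rfl)
    · exact h.2 (Or.inr (by rw [Sym2.eq_swap]; rfl))
  refine not_crossing_union hδ Q hj hτ (fun z hz hz' => ?_)
    (by rwa [Set.singleton_union]) ?_ ?_ ?_
  · have h1 := openEdgeUnion_singleton_subset δ cc cc' hz
    rcases mem_openEdgeUnion_insert hz' with h2 | hz'
    · exact segment_disjoint_of_ne hδ.ne' hcccc' hc'c n₁ n₂ n₅ n₆ h1 h2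
    rcases mem_openEdgeUnion_insert hz' with h2 | hz'
    · exact segment_disjoint_of_ne hδ.ne' hcccc' hcp n₂ n₃ n₆ n₇ h1 h2
    · exact segment_disjoint_of_ne hδ.ne' hcccc' hpq n₃ n₄ n₇ n₈ h1
        (openEdgeUnion_singleton_subset δ p q hz')
  · intro x x' _ hx hL
    rcases eq_or_eq_of_sym2_eq (Set.mem_singleton_iff.1 hx) with rfl | rfl
    exacts [hccR (link_mono δ Q hsub hL), hcc' (link_mono δ Q hsub hL)]
  · intro y y' _ hy hL
    have hL' := link_mono δ Q hsub hL
    rcases hy with hy | hy | hy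
    · rcases eq_or_eq_of_sym2_eq hy with rfl | rfl
      · exact hσ (crossing_of_two_links Q hj hL' hc'R)
      · exact not_joinedIn_of_isolated hδ Q hisoc _ hL.choose_spec.2
    · rcases eq_or_eq_of_sym2_eq hy with rfl | rfl
      · exact not_joinedIn_of_isolated hδ Q hisoc _ hL.choose_spec.2
      · exact not_joinedIn_of_isolated hδ Q hisop _ hL.choose_spec.2
    · rcases eq_or_eq_of_sym2_eq (Set.mem_singleton_iff.1 hy) with rfl | rfl
      · exact not_joinedIn_of_isolated hδ Q hisop _ hL.choose_spec.2
      · exact hqL hL'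
  · intro x x' y y' _ hx _ hy hJ
    have hJ' := joinedIn_mono_config δ Q hsub hJ
    have hy' : y = c' ∨ y = q ∨ (y = c ∨ y = p) := by
      rcases hy with hy | hy | hy
      · rcases eq_or_eq_of_sym2_eq hy with rfl | rfl
        exacts [Or.inl rfl, Or.inr (Or.inr (Or.inl rfl))]
      · rcases eq_or_eq_of_sym2_eq hy with rfl | rfl
        exacts [Or.inr (Or.inr (Or.inl rfl)), Or.inr (Or.inr (Or.inr rfl))]
      · rcases eq_or_eq_of_sym2_eq (Set.mem_singleton_iff.1 hy) with rfl | rfl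
        exacts [Or.inr (Or.inr (Or.inr rfl)), Or.inr (Or.inl rfl)]
    have hx' : x = cc ∨ x = cc' := eq_or_eq_of_sym2_eq (Set.mem_singleton_iff.1 hx)
    rcases hy' with rfl | rfl | hy'
    · rcases hx' with rfl | rfl
      exacts [hccR (link_of_joinedIn hc'R hJ'.symm), hcc' (link_of_joinedIn hc'R hJ'.symm)]
    · rcases hx' with rfl | rfl
      exacts [hccR (link_of_joinedIn hqR hJ'.symm), hcc' (link_of_joinedIn hqR hJ'.symm)]
    · rcases hy' with rfl | rfl
      exacts [not_joinedIn_of_isolated hδ Q hisoc _ hJ, not_joinedIn_of_isolated hδ Q hisop _ hJ]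

end Summit.CriticalPhenomena.CardyFormulaZ2.Theorems.CardySelfRefinement

end
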